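import Summits.AtomisticToContinuum.Crystallization.Theorems.PhononSlackCertificatesPeriodicGivenLayeredRegistry1
import Summits.AtomisticToContinuum.Crystallization.Theorems.PhononSlackCertificatesPeriodicGivenLayeredOneCrossing

/-!
# `PeriodicGivenLayered` (stmt-AtomisticToContinuum-11779), line `Sketch`, stub `stub_registry`, helper 2

The qualitative half of the registry stub (card `alternating-majorisation-one-crossing`), with the Gaussian layer
sum `θ^a_δ(t) = layerInteraction (fun r => Real.exp (-t * r ^ 2)) a 0 δ 0` of helper 1:

* `reg_barlowCoupling_eq_integral`: `barlowCoupling lennardJones a H 1 = ∫_0^∞ g_a(t) w(t) e^{-tH²} dt` with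
  `g_a = θ^a_0 - θ^a_1 ≥ 0` and `w = lennardJonesDensity` (Bernstein + Fubini, helper 1);
* `reg_stub_of_certificates`: sign and monotonicity of the registry coupling on `[39a/25, ∞)` and the corner gap
  `D_a(117a/50) - D_a(17a/10) ≥ c₀ > 0`, uniformly in `a ∈ [47/50, 1]`, follow from THREE numerical
  certificates about the `a = 1` layer sum `G = θ¹_0 - θ¹_1` — one-crossing transport for `w` and `t w(t)`
  (`LayeredHull.nonpos_of_nonpos_of_le`); monotonicity without derivatives from the kernel inequality
  `w(t)(1 - e^{-tΔ}) ≤ κ t w(t)`, `κ = (1 - e^{-t₀Δ})/t₀` (`(1 - e^{-x})/x` decreases); scaling `g_a(t) = G(a²t)`.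
-/

noncomputable section

namespace Summit.AtomisticToContinuum.Crystallization.Theorems.LayeredHull

open MeasureTheory Set Real Filter
open scoped BigOperators Nat
open Literature.MathematicalPhysics.StatisticalMechanics Literature.Algebra.EuclideanLattices

/-! ## The Lennard-Jones layer sums -/

/-- `V_LJ ‖i u + j v + δ w + H e₃‖ = (‖i u + j v + δ w‖² + H²)⁻⁶/12 - (…)⁻³/6`. [folklore] -/
theorem reg_lennardJones_norm_layerVec (a H : ℝ) (δ i j : ℤ) :
    lennardJones ‖layerVec a H δ 1 i j‖ =
      (1 / 12) * ((‖layerVec a 0 δ 0 i j‖ ^ 2 + H ^ 2) ^ 6)⁻¹ -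
        (1 / 6) * ((‖layerVec a 0 δ 0 i j‖ ^ 2 + H ^ 2) ^ 3)⁻¹ := by
  unfold lennardJones
  rw [← reg_norm_layerVec_height_sq, inv_pow, inv_pow, ← pow_mul, ← pow_mul]

/-- **The interaction with a shifted layer as a transform of the Gaussian layer sum**: for `a > 0`,
`H ≠ 0` and `δ ∈ {0, 1}`,
`layerInteraction lennardJones a H δ 1 = ∫_0^∞ θ^a_δ(t) (t⁵/1440 - t²/12) e^{-tH²} dt`. [folklore] -/
theorem reg_layerInteraction_eq_integral {a H : ℝ} (ha : 0 < a) (hH : H ≠ 0) (δ : ℤ) (hδ : δ = 0 ∨ δ = 1) :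
    layerInteraction lennardJones a H δ 1 =
      ∫ t in Ioi (0 : ℝ), layerInteraction (fun r => Real.exp (-t * r ^ 2)) a 0 δ 0 * lennardJonesDensity t * Real.exp (-(t * H ^ 2)) := by
  have hH2 : 0 < H ^ 2 := by positivity
  have h6 := (reg_hasSum_inv_pow_integral ha hH δ hδ 5 (by norm_num)).tsum_eq
  have h3 := (reg_hasSum_inv_pow_integral ha hH δ hδ 2 (by norm_num)).tsum_eq
  have hs6 := reg_summable_inv_pow_layer ha hH δ hδ 6 (by norm_num)
  have hs3 := reg_summable_inv_pow_layer ha hH δ hδ 3 (by norm_num)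
  have hi5 := reg_integrableOn_theta_mul ha.ne' δ hH2 5 (by norm_num)
  have hi2 := reg_integrableOn_theta_mul ha.ne' δ hH2 2 (by norm_num)
  simp only [Nat.factorial, Nat.succ_eq_add_one, Nat.cast_ofNat, Nat.reduceAdd, Nat.reduceMul] at h6 h3
  unfold layerInteraction
  have hV : ∀ ij : ℤ × ℤ, lennardJones ‖layerVec a H δ 1 ij.1 ij.2‖ =
      (1 / 1440) * ((120 : ℝ) / (‖layerVec a 0 δ 0 ij.1 ij.2‖ ^ 2 + H ^ 2) ^ (5 + 1)) -
        (1 / 12) * ((2 : ℝ) / (‖layerVec a 0 δ 0 ij.1 ij.2‖ ^ 2 + H ^ 2) ^ (2 + 1)) := fun ij => by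
    rw [reg_lennardJones_norm_layerVec]
    ring
  have hs6' : Summable fun ij : ℤ × ℤ =>
      (1 / 1440) * ((120 : ℝ) / (‖layerVec a 0 δ 0 ij.1 ij.2‖ ^ 2 + H ^ 2) ^ (5 + 1)) :=
    ((hs6.mul_left 120).mul_left (1 / 1440)).congr fun ij => by ring
  have hs3' : Summable fun ij : ℤ × ℤ =>
      (1 / 12) * ((2 : ℝ) / (‖layerVec a 0 δ 0 ij.1 ij.2‖ ^ 2 + H ^ 2) ^ (2 + 1)) :=
    ((hs3.mul_left 2).mul_left (1 / 12)).congr fun ij => by ring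
  rw [tsum_congr hV, Summable.tsum_sub hs6' hs3', tsum_mul_left, tsum_mul_left, h6, h3,
    ← integral_const_mul, ← integral_const_mul, ← integral_sub (hi5.const_mul _) (hi2.const_mul _)]
  refine setIntegral_congr_fun measurableSet_Ioi fun t _ => ?_
  simp only [lennardJonesDensity, layerInteraction]
  ring

/-- Integrability of `t ↦ (θ^a_0 - θ^a_1)(t) P(t) e^{-ts}` on `(0, ∞)` for `s > 0` and `P` a combination of
`t², t³, t⁵, t⁶` (the only weights that occur below). [folklore] -/
theorem reg_integrableOn_diff_poly {a : ℝ} (ha : a ≠ 0) {s : ℝ} (hs : 0 < s) (c₂ c₃ c₅ c₆ : ℝ) :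
    IntegrableOn (fun t => (layerInteraction (fun r => Real.exp (-t * r ^ 2)) a 0 0 0 - layerInteraction (fun r => Real.exp (-t * r ^ 2)) a 0 1 0) *
      (c₂ * t ^ 2 + c₃ * t ^ 3 + c₅ * t ^ 5 + c₆ * t ^ 6) * Real.exp (-(t * s))) (Ioi 0) := by
  have h : ∀ n : ℕ, 2 ≤ n → IntegrableOn
      (fun t => (layerInteraction (fun r => Real.exp (-t * r ^ 2)) a 0 0 0 - layerInteraction (fun r => Real.exp (-t * r ^ 2)) a 0 1 0) * t ^ n * Real.exp (-(t * s))) (Ioi 0) := fun n hn => by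
    refine IntegrableOn.congr_fun ((reg_integrableOn_theta_mul ha 0 hs n hn).sub
      (reg_integrableOn_theta_mul ha 1 hs n hn)) (fun t _ => ?_) measurableSet_Ioi
    simp only [Pi.sub_apply]
    ring
  refine IntegrableOn.congr_fun (((((h 2 (by norm_num)).const_mul c₂).add ((h 3 (by norm_num)).const_mul c₃)).add
    ((h 5 (by norm_num)).const_mul c₅)).add ((h 6 (by norm_num)).const_mul c₆)) (fun t _ => ?_) measurableSet_Ioi
  simp only [Pi.add_apply]
  ring

/-- **The registry coupling as a one-crossing transform**: for `a > 0` and `H ≠ 0`,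
`barlowCoupling lennardJones a H 1 = ∫_0^∞ (θ^a_0 - θ^a_1)(t) w(t) e^{-tH²} dt`, `w = lennardJonesDensity`.
[folklore] -/
theorem reg_barlowCoupling_eq_integral {a H : ℝ} (ha : 0 < a) (hH : H ≠ 0) :
    barlowCoupling lennardJones a H 1 =
      ∫ t in Ioi (0 : ℝ), (layerInteraction (fun r => Real.exp (-t * r ^ 2)) a 0 0 0 - layerInteraction (fun r => Real.exp (-t * r ^ 2)) a 0 1 0) * lennardJonesDensity t * Real.exp (-(t * H ^ 2)) := by
  have hH2 : 0 < H ^ 2 := by positivity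
  have hint : ∀ δ : ℤ, IntegrableOn
      (fun t => layerInteraction (fun r => Real.exp (-t * r ^ 2)) a 0 δ 0 * lennardJonesDensity t * Real.exp (-(t * H ^ 2))) (Ioi 0) := by
    intro δ
    have h5 := reg_integrableOn_theta_mul ha.ne' δ hH2 5 (by norm_num)
    have h2 := reg_integrableOn_theta_mul ha.ne' δ hH2 2 (by norm_num)
    refine IntegrableOn.congr_fun ((h5.const_mul (1 / 1440)).sub (h2.const_mul (1 / 12))) (fun t _ => ?_)
      measurableSet_Ioi
    simp only [lennardJonesDensity, Pi.sub_apply]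
    ring
  unfold barlowCoupling
  rw [Nat.cast_one, reg_layerInteraction_eq_integral ha hH 0 (Or.inl rfl),
    reg_layerInteraction_eq_integral ha hH 1 (Or.inr rfl), ← integral_sub (hint 0) (hint 1)]
  refine setIntegral_congr_fun measurableSet_Ioi fun t _ => ?_
  ring

/-! ## Scaling in the lattice spacing -/

/-- `θ^a_δ(t) = θ¹_δ(a² t)`. [folklore] -/
theorem reg_theta_scale (a : ℝ) (δ : ℤ) (t : ℝ) : layerInteraction (fun r => Real.exp (-t * r ^ 2)) a 0 δ 0 = layerInteraction (fun r => Real.exp (-(a ^ 2 * t) * r ^ 2)) 1 0 δ 0 := by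
  rw [reg_theta_def, reg_theta_def]
  exact tsum_congr fun ij => by rw [reg_norm_layerVec_scale_sq]; ring_nf

/-- Substitution `u = a² t`: `∫_{(0,∞)} F(a² t) dt = (a²)⁻¹ ∫_{(0,∞)} F(u) du` for `a > 0`. [folklore] -/
theorem reg_integral_comp_sq_mul {a : ℝ} (ha : 0 < a) (F : ℝ → ℝ) :
    ∫ t in Ioi (0 : ℝ), F (a ^ 2 * t) = (a ^ 2)⁻¹ * ∫ u in Ioi (0 : ℝ), F u := by
  have h := integral_comp_mul_left_Ioi F 0 (by positivity : 0 < a ^ 2)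
  rwa [mul_zero, smul_eq_mul] at h

/-! ## The monotonicity kernel -/

/-- `(1 - e^{-x})/x` decreases: `p (1 - e^{-q}) ≤ q (1 - e^{-p})` for `0 < p ≤ q` (convexity of `exp`). [folklore] -/
theorem reg_mul_one_sub_exp_le {p q : ℝ} (hp : 0 < p) (hpq : p ≤ q) :
    p * (1 - Real.exp (-q)) ≤ q * (1 - Real.exp (-p)) := by
  have hq : 0 < q := lt_of_lt_of_le hp hpq
  set l := p / q with hl
  have hl0 : 0 ≤ l := by positivity
  have hl1 : l ≤ 1 := (div_le_one hq).2 hpq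
  have hlq : l * q = p := by rw [hl]; field_simp
  have h := convexOn_exp.2 (Set.mem_univ (-q)) (Set.mem_univ 0) hl0 (by linarith : 0 ≤ 1 - l) (by ring)
  simp only [smul_eq_mul, mul_zero, add_zero, Real.exp_zero, mul_one] at h
  rw [show l * -q = -p by rw [← hlq]; ring] at h
  have h2 : q * Real.exp (-p) ≤ p * Real.exp (-q) + (q - p) := by
    have := mul_le_mul_of_nonneg_left h hq.le
    calc q * Real.exp (-p) ≤ q * (l * Real.exp (-q) + (1 - l)) := this
      _ = p * Real.exp (-q) + (q - p) := by rw [← hlq]; ring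
  linarith

/-- **The monotonicity kernel.** If `W ≤ 0` on `(0, t₀)` and `W ≥ 0` on `[t₀, ∞)` (`t₀ > 0`), then for `Δ ≥ 0`
and `t > 0`: `W(t) (1 - e^{-tΔ}) ≤ ((1 - e^{-t₀Δ})/t₀) · t W(t)`. [folklore] -/
theorem reg_kernel_le {W : ℝ → ℝ} {t₀ : ℝ} (ht₀ : 0 < t₀) (hWneg : ∀ t ∈ Set.Ioo 0 t₀, W t ≤ 0)
    (hWpos : ∀ t, t₀ ≤ t → 0 ≤ W t) {Δ : ℝ} (hΔ : 0 ≤ Δ) {t : ℝ} (ht : 0 < t) :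
    W t * (1 - Real.exp (-(t * Δ))) ≤ (1 - Real.exp (-(t₀ * Δ))) / t₀ * (t * W t) := by
  rcases hΔ.eq_or_lt with h0 | hΔ0
  · rw [← h0]
    simp
  rw [div_mul_eq_mul_div, le_div_iff₀ ht₀]
  rcases le_or_gt t₀ t with hcase | hcase
  · have h1 := reg_mul_one_sub_exp_le (mul_pos ht₀ hΔ0) (mul_le_mul_of_nonneg_right hcase hΔ0.le)
    have h2 : t₀ * (1 - Real.exp (-(t * Δ))) ≤ t * (1 - Real.exp (-(t₀ * Δ))) := by nlinarith
    nlinarith [hWpos t hcase]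
  · have h1 := reg_mul_one_sub_exp_le (mul_pos ht hΔ0) (mul_le_mul_of_nonneg_right hcase.le hΔ0.le)
    have h2 : t * (1 - Real.exp (-(t₀ * Δ))) ≤ t₀ * (1 - Real.exp (-(t * Δ))) := by nlinarith
    nlinarith [hWneg t ⟨ht, hcase⟩]

/-! ## The scaled certificates -/

/-- **Scaling of a certificate.** A certificate `∫_0^∞ G(u) uᵏ (u³/τ³ - 1) e^{-u x²} du ≤ c` about the unit-spacing
layer sum `G = θ¹_0 - θ¹_1` (`τ = 87/20`) becomes, after `u = a² t`,
`∫_0^∞ g_a(t) tᵏ (a⁶ t³/τ³ - 1) e^{-t (x a)²} dt ≤ c / a^{2k+2}` for the spacing-`a` layer sum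
`g_a(t) = G(a² t)`. [folklore] -/
theorem reg_scaled_certificate {a : ℝ} (ha : 0 < a) (k : ℕ) (x c : ℝ)
    (hN : ∫ u in Ioi (0 : ℝ), (layerInteraction (fun r => Real.exp (-u * r ^ 2)) 1 0 0 0 - layerInteraction (fun r => Real.exp (-u * r ^ 2)) 1 0 1 0) * (u ^ k * (u ^ 3 / (87 / 20) ^ 3 - 1)) *
      Real.exp (-(u * x ^ 2)) ≤ c) :
    ∫ t in Ioi (0 : ℝ), (layerInteraction (fun r => Real.exp (-t * r ^ 2)) a 0 0 0 - layerInteraction (fun r => Real.exp (-t * r ^ 2)) a 0 1 0) * (t ^ k * (a ^ 6 * t ^ 3 / (87 / 20) ^ 3 - 1)) *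
      Real.exp (-(t * (x * a) ^ 2)) ≤ c / a ^ (2 * k + 2) := by
  set F : ℝ → ℝ := fun u => (layerInteraction (fun r => Real.exp (-u * r ^ 2)) 1 0 0 0 - layerInteraction (fun r => Real.exp (-u * r ^ 2)) 1 0 1 0) * (u ^ k * (u ^ 3 / (87 / 20) ^ 3 - 1)) *
    Real.exp (-(u * x ^ 2)) with hF
  have h := reg_integral_comp_sq_mul ha F
  have hFt : ∀ t : ℝ, F (a ^ 2 * t) = a ^ (2 * k) * ((layerInteraction (fun r => Real.exp (-t * r ^ 2)) a 0 0 0 - layerInteraction (fun r => Real.exp (-t * r ^ 2)) a 0 1 0) *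
      (t ^ k * (a ^ 6 * t ^ 3 / (87 / 20) ^ 3 - 1)) * Real.exp (-(t * (x * a) ^ 2))) := by
    intro t
    simp only [hF]
    rw [← reg_theta_scale a 0 t, ← reg_theta_scale a 1 t,
      show -(a ^ 2 * t * x ^ 2) = -(t * (x * a) ^ 2) by ring]
    ring
  rw [setIntegral_congr_fun measurableSet_Ioi (fun t _ => hFt t), integral_const_mul] at h
  have h2 : (a ^ 2)⁻¹ * ∫ u in Ioi (0 : ℝ), F u ≤ (a ^ 2)⁻¹ * c :=
    mul_le_mul_of_nonneg_left hN (by positivity)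
  rw [← h] at h2
  have h3 := mul_le_mul_of_nonneg_left h2 (sq_nonneg a)
  rw [le_div_iff₀ (by positivity)]
  calc (∫ t in Ioi (0 : ℝ), (layerInteraction (fun r => Real.exp (-t * r ^ 2)) a 0 0 0 - layerInteraction (fun r => Real.exp (-t * r ^ 2)) a 0 1 0) * (t ^ k * (a ^ 6 * t ^ 3 / (87 / 20) ^ 3 - 1)) *
        Real.exp (-(t * (x * a) ^ 2))) * a ^ (2 * k + 2)
      = a ^ 2 * (a ^ (2 * k) * ∫ t in Ioi (0 : ℝ), (layerInteraction (fun r => Real.exp (-t * r ^ 2)) a 0 0 0 - layerInteraction (fun r => Real.exp (-t * r ^ 2)) a 0 1 0) *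
          (t ^ k * (a ^ 6 * t ^ 3 / (87 / 20) ^ 3 - 1)) * Real.exp (-(t * (x * a) ^ 2))) := by ring
    _ ≤ a ^ 2 * ((a ^ 2)⁻¹ * c) := h3
    _ = c := by field_simp

/-! ## The reduction of the stub to three certificates -/

/-- **The registry stub from three numerical certificates.** Let `G = θ¹_0 - θ¹_1` be the unit-spacing
aligned-minus-offset Gaussian layer sum and `τ = 87/20`. If
`∫_0^∞ G(u) u² (u³/τ³ - 1) e^{-u (39/25)²} du ≤ 0`, `∫_0^∞ G(u) u³ (u³/τ³ - 1) e^{-u (39/25)²} du ≤ 0` and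
`∫_0^∞ G(u) u³ (u³/τ³ - 1) e^{-u (17/10)²} du ≤ -V < 0`, then for every `a ∈ [47/50, 1]` the registry coupling
`D_a(H) = barlowCoupling lennardJones a H 1` is `≤ 0` and non-decreasing on `[39a/25, ∞)` and
`D_a(117a/50) - D_a(17a/10) ≥ V/75` (one-crossing transport of the sign of `∫ g_a w e^{-ts}` and of
`∫ g_a (t w) e^{-ts}` from `s = (39a/25)²`, `w = t⁵/1440 - t²/12 ≤ t²(a⁶t³/τ³ - 1)/12` since `τ³ ≤ 120 a⁶`).
[folklore] -/
theorem reg_stub_of_certificates (V : ℝ) (hV : 0 < V)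
    (N1 : ∫ u in Set.Ioi (0 : ℝ), (layerInteraction (fun r => Real.exp (-u * r ^ 2)) 1 0 0 0 - layerInteraction (fun r => Real.exp (-u * r ^ 2)) 1 0 1 0) * (u ^ 2 * (u ^ 3 / (87 / 20) ^ 3 - 1)) *
      Real.exp (-(u * (39 / 25) ^ 2)) ≤ 0)
    (N2 : ∫ u in Set.Ioi (0 : ℝ), (layerInteraction (fun r => Real.exp (-u * r ^ 2)) 1 0 0 0 - layerInteraction (fun r => Real.exp (-u * r ^ 2)) 1 0 1 0) * (u ^ 3 * (u ^ 3 / (87 / 20) ^ 3 - 1)) *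
      Real.exp (-(u * (39 / 25) ^ 2)) ≤ 0)
    (N3 : ∫ u in Set.Ioi (0 : ℝ), (layerInteraction (fun r => Real.exp (-u * r ^ 2)) 1 0 0 0 - layerInteraction (fun r => Real.exp (-u * r ^ 2)) 1 0 1 0) * (u ^ 3 * (u ^ 3 / (87 / 20) ^ 3 - 1)) *
      Real.exp (-(u * (17 / 10) ^ 2)) ≤ -V) :
    ∃ c₀ : ℝ, 0 < c₀ ∧ ∀ a : ℝ, 47 / 50 ≤ a → a ≤ 1 →
      (∀ H H' : ℝ, 39 / 25 * a ≤ H → H ≤ H' →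
        barlowCoupling lennardJones a H' 1 ≤ 0 ∧
          barlowCoupling lennardJones a H 1 ≤ barlowCoupling lennardJones a H' 1) ∧
      c₀ ≤ barlowCoupling lennardJones a (117 / 50 * a) 1 - barlowCoupling lennardJones a (17 / 10 * a) 1 := by
  refine ⟨V / 75, by positivity, fun a ha ha1 => ?_⟩
  have ha0 : 0 < a := by linarith
  -- the density, its crossing point `t₀ = 120^{1/3}`, and the one-crossing data
  set t₀ : ℝ := (120 : ℝ) ^ (1 / 3 : ℝ) with ht₀
  have ht₀3 : t₀ ^ 3 = 120 := rpow_oneThird_pow_three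
  have ht₀pos : 0 < t₀ := by positivity
  have ht₀le : t₀ ≤ 5 := by
    by_contra h
    have := pow_lt_pow_left₀ (not_le.1 h) (by norm_num) (three_ne_zero)
    linarith
  have ht₀ge : 4 ≤ t₀ := by
    by_contra h
    have := pow_lt_pow_left₀ (not_le.1 h) ht₀pos.le (three_ne_zero)
    linarith
  have hwneg : ∀ t ∈ Set.Ioo 0 t₀, lennardJonesDensity t ≤ 0 := fun t ht =>
    lennardJonesDensity_nonpos ht.1 ht.2
  have hwpos : ∀ t, t₀ ≤ t → 0 ≤ lennardJonesDensity t := fun t ht => lennardJonesDensity_nonneg ht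
  have hw1neg : ∀ t ∈ Set.Ioo 0 t₀, (fun t => t * lennardJonesDensity t) t ≤ 0 := fun t ht =>
    mul_nonpos_of_nonneg_of_nonpos ht.1.le (lennardJonesDensity_nonpos ht.1 ht.2)
  have hw1pos : ∀ t, t₀ ≤ t → 0 ≤ (fun t => t * lennardJonesDensity t) t := fun t ht =>
    mul_nonneg (ht₀pos.le.trans ht) (lennardJonesDensity_nonneg ht)
  -- the layer sum `g_a ≥ 0` and the integrability of its transforms
  have hg0 : ∀ t, 0 < t → 0 ≤ (fun t => layerInteraction (fun r => Real.exp (-t * r ^ 2)) a 0 0 0 - layerInteraction (fun r => Real.exp (-t * r ^ 2)) a 0 1 0) t := fun t ht =>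
    sub_nonneg.2 (reg_theta_le_theta_zero ha0.ne' 1 ht)
  have hint : ∀ s : ℝ, 0 < s → IntegrableOn (fun t => (fun t => layerInteraction (fun r => Real.exp (-t * r ^ 2)) a 0 0 0 - layerInteraction (fun r => Real.exp (-t * r ^ 2)) a 0 1 0) t *
      lennardJonesDensity t * Real.exp (-(t * s))) (Ioi 0) := fun s hs => by
    refine IntegrableOn.congr_fun (reg_integrableOn_diff_poly ha0.ne' hs (-(1 / 12)) 0 (1 / 1440) 0)
      (fun t _ => ?_) measurableSet_Ioi
    simp only [lennardJonesDensity]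
    ring
  have hint1 : ∀ s : ℝ, 0 < s → IntegrableOn (fun t => (fun t => layerInteraction (fun r => Real.exp (-t * r ^ 2)) a 0 0 0 - layerInteraction (fun r => Real.exp (-t * r ^ 2)) a 0 1 0) t *
      (fun t => t * lennardJonesDensity t) t * Real.exp (-(t * s))) (Ioi 0) := fun s hs => by
    refine IntegrableOn.congr_fun (reg_integrableOn_diff_poly ha0.ne' hs 0 (-(1 / 12)) 0 (1 / 1440))
      (fun t _ => ?_) measurableSet_Ioi
    simp only [lennardJonesDensity]
    ring
  -- the comparison densities `w ≤ P₂`, `t w ≤ P₃` (`τ³ ≤ 120 a⁶`)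
  have hτ : (87 / 20 : ℝ) ^ 3 ≤ 120 * a ^ 6 := by
    have : (47 / 50 : ℝ) ^ 6 ≤ a ^ 6 := pow_le_pow_left₀ (by norm_num) ha 6
    nlinarith
  have hcmp2 : ∀ t, 0 < t → lennardJonesDensity t ≤
      (1 / 12) * (t ^ 2 * (a ^ 6 * t ^ 3 / (87 / 20) ^ 3 - 1)) := fun t ht => by
    simp only [lennardJonesDensity]
    have h5 := mul_le_mul_of_nonneg_left hτ (by positivity : (0 : ℝ) ≤ t ^ 5)
    have e : (1 : ℝ) / 12 * (t ^ 2 * (a ^ 6 * t ^ 3 / (87 / 20) ^ 3 - 1)) =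
        (t ^ 5 * (120 * a ^ 6)) / (1440 * (87 / 20) ^ 3) - t ^ 2 / 12 := by ring
    rw [e, div_eq_mul_inv (t ^ 5 * (120 * a ^ 6)), show t ^ 5 / 1440 =
      t ^ 5 * (87 / 20 : ℝ) ^ 3 * (1440 * (87 / 20 : ℝ) ^ 3)⁻¹ by field_simp]
    have : 0 < (1440 * (87 / 20 : ℝ) ^ 3)⁻¹ := by positivity
    nlinarith
  have hcmp3 : ∀ t, 0 < t → t * lennardJonesDensity t ≤
      (1 / 12) * (t ^ 3 * (a ^ 6 * t ^ 3 / (87 / 20) ^ 3 - 1)) := fun t ht => by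
    have := mul_le_mul_of_nonneg_left (hcmp2 t ht) ht.le
    calc t * lennardJonesDensity t ≤ t * ((1 / 12) * (t ^ 2 * (a ^ 6 * t ^ 3 / (87 / 20) ^ 3 - 1))) := this
      _ = _ := by ring
  -- the three scaled certificates
  have hA1 := reg_scaled_certificate ha0 2 (39 / 25) 0 N1
  have hA2 := reg_scaled_certificate ha0 3 (39 / 25) 0 N2
  have hA3 := reg_scaled_certificate ha0 3 (17 / 10) (-V) N3
  rw [zero_div] at hA1 hA2
  have ha8 : -V / a ^ (2 * 3 + 2) ≤ -V := by
    rw [div_le_iff₀ (by positivity), neg_mul, neg_le_neg_iff]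
    exact mul_le_of_le_one_right hV.le (pow_le_one₀ ha0.le ha1)
  replace hA3 := hA3.trans ha8
  set S₁ : ℝ := (39 / 25 * a) ^ 2 with hS₁
  set S₂ : ℝ := (17 / 10 * a) ^ 2 with hS₂
  set S₃ : ℝ := (117 / 50 * a) ^ 2 with hS₃
  have hS₁pos : 0 < S₁ := by positivity
  have hS₂pos : 0 < S₂ := by positivity
  -- the transforms `Φ(s) = ∫ g w e^{-ts}` (`= D_a(√s)`) and `Ψ(s) = ∫ g (t w) e^{-ts}` at the certificate points
  have hΦ₁ : ∫ t in Ioi (0 : ℝ), (fun t => layerInteraction (fun r => Real.exp (-t * r ^ 2)) a 0 0 0 - layerInteraction (fun r => Real.exp (-t * r ^ 2)) a 0 1 0) t * lennardJonesDensity t *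
      Real.exp (-(t * S₁)) ≤ 0 :=
    calc _ ≤ ∫ t in Ioi (0 : ℝ), (layerInteraction (fun r => Real.exp (-t * r ^ 2)) a 0 0 0 - layerInteraction (fun r => Real.exp (-t * r ^ 2)) a 0 1 0) *
          ((1 / 12) * (t ^ 2 * (a ^ 6 * t ^ 3 / (87 / 20) ^ 3 - 1))) * Real.exp (-(t * S₁)) :=
          setIntegral_mono_on (hint S₁ hS₁pos) (IntegrableOn.congr_fun (reg_integrableOn_diff_poly ha0.ne'
            hS₁pos (-(1 / 12)) 0 (a ^ 6 / (12 * (87 / 20) ^ 3)) 0) (fun t _ => by ring) measurableSet_Ioi)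
            measurableSet_Ioi fun t (ht : 0 < t) => mul_le_mul_of_nonneg_right
              (mul_le_mul_of_nonneg_left (hcmp2 t ht) (hg0 t ht)) (Real.exp_pos _).le
      _ = (1 / 12) * ∫ t in Ioi (0 : ℝ), (layerInteraction (fun r => Real.exp (-t * r ^ 2)) a 0 0 0 - layerInteraction (fun r => Real.exp (-t * r ^ 2)) a 0 1 0) *
          (t ^ 2 * (a ^ 6 * t ^ 3 / (87 / 20) ^ 3 - 1)) * Real.exp (-(t * S₁)) := by
          rw [← integral_const_mul]
          exact setIntegral_congr_fun measurableSet_Ioi fun t _ => by ring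
      _ ≤ 0 := mul_nonpos_of_nonneg_of_nonpos (by norm_num) hA1
  have hΨ₁ : ∫ t in Ioi (0 : ℝ), (fun t => layerInteraction (fun r => Real.exp (-t * r ^ 2)) a 0 0 0 - layerInteraction (fun r => Real.exp (-t * r ^ 2)) a 0 1 0) t *
      (fun t => t * lennardJonesDensity t) t * Real.exp (-(t * S₁)) ≤ 0 :=
    calc _ ≤ ∫ t in Ioi (0 : ℝ), (layerInteraction (fun r => Real.exp (-t * r ^ 2)) a 0 0 0 - layerInteraction (fun r => Real.exp (-t * r ^ 2)) a 0 1 0) *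
          ((1 / 12) * (t ^ 3 * (a ^ 6 * t ^ 3 / (87 / 20) ^ 3 - 1))) * Real.exp (-(t * S₁)) :=
          setIntegral_mono_on (hint1 S₁ hS₁pos) (IntegrableOn.congr_fun (reg_integrableOn_diff_poly ha0.ne'
            hS₁pos 0 (-(1 / 12)) 0 (a ^ 6 / (12 * (87 / 20) ^ 3))) (fun t _ => by ring) measurableSet_Ioi)
            measurableSet_Ioi fun t (ht : 0 < t) => mul_le_mul_of_nonneg_right
              (mul_le_mul_of_nonneg_left (hcmp3 t ht) (hg0 t ht)) (Real.exp_pos _).le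
      _ = (1 / 12) * ∫ t in Ioi (0 : ℝ), (layerInteraction (fun r => Real.exp (-t * r ^ 2)) a 0 0 0 - layerInteraction (fun r => Real.exp (-t * r ^ 2)) a 0 1 0) *
          (t ^ 3 * (a ^ 6 * t ^ 3 / (87 / 20) ^ 3 - 1)) * Real.exp (-(t * S₁)) := by
          rw [← integral_const_mul]
          exact setIntegral_congr_fun measurableSet_Ioi fun t _ => by ring
      _ ≤ 0 := mul_nonpos_of_nonneg_of_nonpos (by norm_num) hA2
  have hΨ₂ : ∫ t in Ioi (0 : ℝ), (fun t => layerInteraction (fun r => Real.exp (-t * r ^ 2)) a 0 0 0 - layerInteraction (fun r => Real.exp (-t * r ^ 2)) a 0 1 0) t *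
      (fun t => t * lennardJonesDensity t) t * Real.exp (-(t * S₂)) ≤ -(V / 12) :=
    calc _ ≤ ∫ t in Ioi (0 : ℝ), (layerInteraction (fun r => Real.exp (-t * r ^ 2)) a 0 0 0 - layerInteraction (fun r => Real.exp (-t * r ^ 2)) a 0 1 0) *
          ((1 / 12) * (t ^ 3 * (a ^ 6 * t ^ 3 / (87 / 20) ^ 3 - 1))) * Real.exp (-(t * S₂)) :=
          setIntegral_mono_on (hint1 S₂ hS₂pos) (IntegrableOn.congr_fun (reg_integrableOn_diff_poly ha0.ne'
            hS₂pos 0 (-(1 / 12)) 0 (a ^ 6 / (12 * (87 / 20) ^ 3))) (fun t _ => by ring) measurableSet_Ioi)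
            measurableSet_Ioi fun t (ht : 0 < t) => mul_le_mul_of_nonneg_right
              (mul_le_mul_of_nonneg_left (hcmp3 t ht) (hg0 t ht)) (Real.exp_pos _).le
      _ = (1 / 12) * ∫ t in Ioi (0 : ℝ), (layerInteraction (fun r => Real.exp (-t * r ^ 2)) a 0 0 0 - layerInteraction (fun r => Real.exp (-t * r ^ 2)) a 0 1 0) *
          (t ^ 3 * (a ^ 6 * t ^ 3 / (87 / 20) ^ 3 - 1)) * Real.exp (-(t * S₂)) := by
          rw [← integral_const_mul]
          exact setIntegral_congr_fun measurableSet_Ioi fun t _ => by ring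
      _ ≤ -(V / 12) := by linarith
  -- one-crossing transport of both signs to every `s ≥ S₁`
  have hΦ : ∀ s, S₁ ≤ s → ∫ t in Ioi (0 : ℝ), (fun t => layerInteraction (fun r => Real.exp (-t * r ^ 2)) a 0 0 0 - layerInteraction (fun r => Real.exp (-t * r ^ 2)) a 0 1 0) t *
      lennardJonesDensity t * Real.exp (-(t * s)) ≤ 0 := fun s hs =>
    nonpos_of_nonpos_of_le hg0 hwneg hwpos hint hS₁pos hs hΦ₁
  have hΨ : ∀ s, S₁ ≤ s → ∫ t in Ioi (0 : ℝ), (fun t => layerInteraction (fun r => Real.exp (-t * r ^ 2)) a 0 0 0 - layerInteraction (fun r => Real.exp (-t * r ^ 2)) a 0 1 0) t *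
      (fun t => t * lennardJonesDensity t) t * Real.exp (-(t * s)) ≤ 0 := fun s hs =>
    nonpos_of_nonpos_of_le hg0 hw1neg hw1pos hint1 hS₁pos hs hΨ₁
  -- monotonicity without derivatives: `Φ(s) - Φ(s') ≤ κ Ψ(s)`, `κ = (1 - e^{-t₀(s'-s)})/t₀ ≥ 0`
  have hstep : ∀ s s' : ℝ, 0 < s → s ≤ s' →
      (∫ t in Ioi (0 : ℝ), (fun t => layerInteraction (fun r => Real.exp (-t * r ^ 2)) a 0 0 0 - layerInteraction (fun r => Real.exp (-t * r ^ 2)) a 0 1 0) t * lennardJonesDensity t *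
        Real.exp (-(t * s))) -
      (∫ t in Ioi (0 : ℝ), (fun t => layerInteraction (fun r => Real.exp (-t * r ^ 2)) a 0 0 0 - layerInteraction (fun r => Real.exp (-t * r ^ 2)) a 0 1 0) t * lennardJonesDensity t *
        Real.exp (-(t * s'))) ≤
      (1 - Real.exp (-(t₀ * (s' - s)))) / t₀ *
        ∫ t in Ioi (0 : ℝ), (fun t => layerInteraction (fun r => Real.exp (-t * r ^ 2)) a 0 0 0 - layerInteraction (fun r => Real.exp (-t * r ^ 2)) a 0 1 0) t *
          (fun t => t * lennardJonesDensity t) t * Real.exp (-(t * s)) := by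
    intro s s' hs hss'
    have hs' : 0 < s' := lt_of_lt_of_le hs hss'
    rw [← integral_sub (hint s hs) (hint s' hs'), ← integral_const_mul]
    refine setIntegral_mono_on ((hint s hs).sub (hint s' hs')) ((hint1 s hs).const_mul _) measurableSet_Ioi
      fun t (ht : 0 < t) => ?_
    have hk := reg_kernel_le ht₀pos hwneg hwpos (sub_nonneg.2 hss') ht
    have hE : Real.exp (-(t * s')) = Real.exp (-(t * s)) * Real.exp (-(t * (s' - s))) := by
      rw [← Real.exp_add]
      ring_nf
    have hge : 0 ≤ (layerInteraction (fun r => Real.exp (-t * r ^ 2)) a 0 0 0 - layerInteraction (fun r => Real.exp (-t * r ^ 2)) a 0 1 0) * Real.exp (-(t * s)) :=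
      mul_nonneg (hg0 t ht) (Real.exp_pos _).le
    calc (layerInteraction (fun r => Real.exp (-t * r ^ 2)) a 0 0 0 - layerInteraction (fun r => Real.exp (-t * r ^ 2)) a 0 1 0) * lennardJonesDensity t * Real.exp (-(t * s)) -
          (layerInteraction (fun r => Real.exp (-t * r ^ 2)) a 0 0 0 - layerInteraction (fun r => Real.exp (-t * r ^ 2)) a 0 1 0) * lennardJonesDensity t * Real.exp (-(t * s'))
        = (layerInteraction (fun r => Real.exp (-t * r ^ 2)) a 0 0 0 - layerInteraction (fun r => Real.exp (-t * r ^ 2)) a 0 1 0) * Real.exp (-(t * s)) *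
            (lennardJonesDensity t * (1 - Real.exp (-(t * (s' - s))))) := by rw [hE]; ring
      _ ≤ (layerInteraction (fun r => Real.exp (-t * r ^ 2)) a 0 0 0 - layerInteraction (fun r => Real.exp (-t * r ^ 2)) a 0 1 0) * Real.exp (-(t * s)) *
            ((1 - Real.exp (-(t₀ * (s' - s)))) / t₀ * (t * lennardJonesDensity t)) :=
          mul_le_mul_of_nonneg_left hk hge
      _ = _ := by ring
  have hκ0 : ∀ s s' : ℝ, s ≤ s' → 0 ≤ (1 - Real.exp (-(t₀ * (s' - s)))) / t₀ := fun s s' h =>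
    div_nonneg (sub_nonneg.2 (Real.exp_le_one_iff.2 (by nlinarith))) ht₀pos.le
  -- `D_a(H) = Φ(H²)`
  have hD : ∀ H : ℝ, 0 < H → barlowCoupling lennardJones a H 1 =
      ∫ t in Ioi (0 : ℝ), (fun t => layerInteraction (fun r => Real.exp (-t * r ^ 2)) a 0 0 0 - layerInteraction (fun r => Real.exp (-t * r ^ 2)) a 0 1 0) t * lennardJonesDensity t *
        Real.exp (-(t * H ^ 2)) := fun H hH => reg_barlowCoupling_eq_integral ha0 hH.ne'
  refine ⟨fun H H' hH hHH' => ?_, ?_⟩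
  · have hHpos : 0 < H := lt_of_lt_of_le (by positivity) hH
    have hH'pos : 0 < H' := lt_of_lt_of_le hHpos hHH'
    have h1 : S₁ ≤ H ^ 2 := pow_le_pow_left₀ (by positivity) hH 2
    have h2 : H ^ 2 ≤ H' ^ 2 := pow_le_pow_left₀ hHpos.le hHH' 2
    refine ⟨by rw [hD H' hH'pos]; exact hΦ _ (h1.trans h2), ?_⟩
    rw [hD H hHpos, hD H' hH'pos, ← sub_nonpos]
    exact (hstep _ _ (by positivity) h2).trans
      (mul_nonpos_of_nonneg_of_nonpos (hκ0 _ _ h2) (hΨ _ h1))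
  · have h17 : 0 < 17 / 10 * a := by positivity
    have h117 : 0 < 117 / 50 * a := by positivity
    rw [hD _ h117, hD _ h17, ← hS₂, ← hS₃]
    have h23 : S₂ ≤ S₃ := by rw [hS₂, hS₃]; nlinarith
    have hs := hstep S₂ S₃ hS₂pos h23
    -- `κ ≥ 4/25`: `t₀ ≤ 5` and `e^{-t₀ Δ} ≤ e^{-2} ≤ 1/5`
    have hΔ : 2 ≤ t₀ * (S₃ - S₂) := by
      have hd : (2 : ℝ) ≤ S₃ - S₂ := by rw [hS₂, hS₃]; nlinarith
      nlinarith
    have he2 : Real.exp (-(t₀ * (S₃ - S₂))) ≤ 1 / 5 := by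
      have h5 : (5 : ℝ) ≤ Real.exp 2 := by
        have := Real.quadratic_le_exp_of_nonneg (by norm_num : (0:ℝ) ≤ 2)
        norm_num at this
        exact this
      calc Real.exp (-(t₀ * (S₃ - S₂))) ≤ Real.exp (-2) := Real.exp_le_exp.2 (by linarith)
        _ = (Real.exp 2)⁻¹ := Real.exp_neg 2
        _ ≤ 1 / 5 := by rw [one_div]; exact inv_anti₀ (by norm_num) h5
    set κ := (1 - Real.exp (-(t₀ * (S₃ - S₂)))) / t₀ with hκdef
    have hκ : 4 / 25 ≤ κ := by
      rw [hκdef, le_div_iff₀ ht₀pos]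
      nlinarith
    have hnegP : V / 12 ≤ -(∫ t in Ioi (0 : ℝ), (fun t => layerInteraction (fun r => Real.exp (-t * r ^ 2)) a 0 0 0 - layerInteraction (fun r => Real.exp (-t * r ^ 2)) a 0 1 0) t *
      (fun t => t * lennardJonesDensity t) t * Real.exp (-(t * S₂))) := by linarith
    have h1 := mul_le_mul hκ hnegP (by positivity) ((by norm_num : (0 : ℝ) ≤ 4 / 25).trans hκ)
    linarith only [hs, h1]

end Summit.AtomisticToContinuum.Crystallization.Theorems.LayeredHull
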